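/-
Origin: expansion seat `planner-pub-hodgecm-pv13-g3-0`, handover #2a 2026-08-18T06:32:59Z (`HOME/pub-hodgecm-pv13-g3/lean/Pv13g3/SplitShells.lean`, md5 3670c8b8, 289 lines);
landed by the gen-7 packager in gate run 25 as `HodgeCM/PerL34/SplitShells.lean` (verbatim).
-/
/-
Copyright: HodgeCM publication cell (pub-hodgecm), DAG node N31 — seam S3, split places, GROUP LEVEL
(prover pv13, gen 3).  Released under the package licence.

# Split-place shells: the six split fields of `UnramifiedPlaceData` from a place valuation

Source under adjudication (NOT cited as a fact; this file PROVES typed pieces of it):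
PerL v5 = `inputs/2001/summits__hodge-w-picard-modular-quadrilinear-period-galois-
closure__free__y1__paper__paper.tex` (= `…__work__paper-v5-d912a121.tex`, 738 l.), Lemma 4.2(b), proof,
tex ll. 610–611 and 628–631, VERBATIM:

  610–611: Each $I_v$ is absolutely convergent ($\U(W_i)(L_{0,v})$ is compact unless $v$ splits in $L$,
           where it is $L_{0,v}^\times$ acting on $\cS(L_{0,v}^3)$ by $(\omega(y)\phi)(x)=|y|^{3/2}
           \phi(yx)$ up to a unitary character, so that $|\langle\omega_v(y)\phi_v,\phi_v\rangle|
           \ll\min(|y|,|y|^{-1})^{3/2}$)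
  628–631: Enlarging $S$, for $v\notin S$ also $\phi_v=\phi_v^0$ and all splitting data are unramified,
           and $I_v(\phi^0_v)=1$ resp.\ $I_v(\phi^0_v)=\sum_{n\in\Z}q_v^{-3|n|/2}a_v^{n}=(1-q_v^{-3})\,
           |1-a_vq_v^{-3/2}|^{-2}$ at split $v$, where $a_v:=\chi'_v(\varpi_v)\nu_v(\varpi_v)$ with
           $\nu_v$ the (unramified) auxiliary character of the Weil representation, $|a_v|=1$ (measures
           giving the maximal compact subgroups volume $1$).

## What this file does (pure group theory + left-invariance; no model, no local field)

pv09-g3's `PureTensor.UnramifiedPlaceData` (CanonicalPieces, run 24) carries at every split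
unramified place `i` SIX fields as INPUT: shells `P i : ℤ → Set (G i)`, measurable (`hm`), pairwise
disjoint (`hd`), covering (`hcover`), of `ν_i`-volume one (`hvol`), on which the canonical local
integrand `(localIntegrand B D ω φ χ′ i).f` is the constant `(q_i^{-3/2})^{|n|} (χ′_i(ϖ) ν_i(ϖ))ⁿ`
(`hF`) — pv10's `UnramifiedFactors` §4 hypotheses.  Here they are DERIVED from place-`i` data of
the kind the tex names ("`ord y`", "`𝒪_v^×`", "unramified"):
* §1–§2 — for any group `Γ` with a valuation `ord : Γ →* Multiplicative ℤ` and `ϖ` with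
  `ord ϖ = 1`: the shells `shell ord n = {ord = n}` (`= ϖⁿ · ker ord`) are pairwise disjoint, cover,
  `shell ord n = (ϖ⁻ⁿ · )⁻¹' (ker ord)`, hence measurable and of the SAME left-Haar measure as
  `ker ord` (`measure_shell`: left-invariance only);
* §3 — for the canonical local integrand of pv09-g3: if `φ` is fixed by `ω(ι_i b)` and `χ′(ι_i b) = 1`
  for `b ∈ ker ord` (= `𝒪_v^×`: l. 628–629 "`φ_v = φ_v⁰` and all splitting data are unramified"), then on
  `shell ord n`
  the integrand is the constant `localCoeff(ϖⁿ) · χ′_i(ϖ)ⁿ` (**`localIntegrand_f_eqOn_shell`**): the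
  whole content of `hF` is the value of the local coefficient on the lattice `{ϖⁿ}`;
* §4 — **`SplitPlaceModel`** = the place-`i` data (`ord`, `ϖ`, `ker ord = B i`, `B i` measurable of
  `ν_i`-volume one, the two invariances, and the lattice values
  `localCoeff(ϖⁿ) = (tOf q)^{|n|} νᵢⁿ`) and **`SplitPlaceModel.hm/hd/hcover/hvol/hF`** = the six
  fields (`hvol`: l. 631 "measures giving the maximal compact subgroups volume 1"; `hF`: the summand
  `q_v^{-3|n|/2} a_vⁿ` of l. 629–630); **`unramifiedPlaceDataOfModels`** assembles pv09-g3's structure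
  from split models at the split places and the non-split data.  The lattice values are supplied
  KERNEL by pv07-g2's dilation model (`LocalFactors.DilationModel.splitIntegrand_f_eqOn_shell_resIndex`,
  run 24, whose `q` is this seat's `LocalModulus.resIndex`) under the D4 dictionary — see
  `SplitPlaceDilation.lean`.
RESIDUAL after this file: none of its own (every hypothesis is place-`i` set-up data or one of the
two displayed invariances); the D4 sentence lives in `SplitPlaceDilation.lean`.
Nothing is cited; no hypothesis names PerL, QW8 or a 2001-programme claim.  Axioms = the standard
trio.  Unit `pub-hodgecm-pv13-g3` (DAG-node prover #13, generation 3), 2026-08-18.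
-/
import Summits.HodgeConjecture.HodgeCM.PerL34.CanonicalPieces

set_option autoImplicit false

noncomputable section

open MeasureTheory Set Function Complex ComplexConjugate

open scoped RestrictedProduct InnerProductSpace

namespace HodgeCM.PerL34.SplitShells

open HodgeCM.PerL34.PureTensor HodgeCM.PerL34.AdelicFactorisation HodgeCM.PerL34.RestrictedMeasure
  HodgeCM.PerL34.EulerFactorisation

/-! ## §1 Shells of a valuation `ord : Γ →* Multiplicative ℤ` -/

section shells

variable {Γ : Type*} [Group Γ]

/-- the `n`-th shell `{g : ord g = n}` (`= ϖⁿ 𝒪^×` in the tex) -/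
def shell (ord : Γ →* Multiplicative ℤ) (n : ℤ) : Set Γ := {g | Multiplicative.toAdd (ord g) = n}

variable (ord : Γ →* Multiplicative ℤ)

/-- (Ported verbatim from the HodgeCMPerL package; no docstring in the source.) -/
theorem mem_shell {n : ℤ} {g : Γ} : g ∈ shell ord n ↔ Multiplicative.toAdd (ord g) = n := Iff.rfl

/-- `shell ord 0 = ker ord` -/
theorem mem_shell_zero {g : Γ} : g ∈ shell ord 0 ↔ ord g = 1 := by
  rw [mem_shell, ← toAdd_one, Multiplicative.toAdd.apply_eq_iff_eq]

/-- (Ported verbatim from the HodgeCMPerL package; no docstring in the source.) -/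
theorem shell_zero_eq {K : Set Γ} (hker : ∀ g, ord g = 1 ↔ g ∈ K) : shell ord 0 = K :=
  Set.ext fun g => (mem_shell_zero ord).trans (hker g)

/-- the shells are pairwise disjoint … -/
theorem pairwise_disjoint_shell : Pairwise (Disjoint on shell ord) := fun _ _ hmn =>
  disjoint_left.mpr fun _ hgm hgn => hmn ((mem_shell ord).1 hgm ▸ (mem_shell ord).1 hgn)

/-- … and cover -/
theorem iUnion_shell : (⋃ n, shell ord n) = univ :=
  eq_univ_of_forall fun g => mem_iUnion.mpr ⟨Multiplicative.toAdd (ord g), rfl⟩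

variable {ord}

/-- (Ported verbatim from the HodgeCMPerL package; no docstring in the source.) -/
theorem toAdd_ord_zpow_mul {ϖ : Γ} (hϖ : ord ϖ = Multiplicative.ofAdd 1) (n : ℤ) (g : Γ) :
    Multiplicative.toAdd (ord (ϖ ^ n * g)) = n + Multiplicative.toAdd (ord g) := by
  rw [map_mul, map_zpow, hϖ, toAdd_mul, toAdd_zpow, toAdd_ofAdd, smul_eq_mul, mul_one]

/-- `ϖⁿ b ∈ shell n` for `b ∈ ker ord` -/
theorem zpow_mul_mem_shell {ϖ : Γ} (hϖ : ord ϖ = Multiplicative.ofAdd 1) {b : Γ} (hb : ord b = 1)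
    (n : ℤ) : ϖ ^ n * b ∈ shell ord n := by
  rw [mem_shell, toAdd_ord_zpow_mul hϖ, hb, toAdd_one, add_zero]

/-- on `shell n` every element is `ϖⁿ b` with `b ∈ ker ord` -/
theorem exists_eq_zpow_mul {ϖ : Γ} (hϖ : ord ϖ = Multiplicative.ofAdd 1) {n : ℤ} {g : Γ}
    (hg : g ∈ shell ord n) : ∃ b, ord b = 1 ∧ g = ϖ ^ n * b := by
  refine ⟨ϖ ^ (-n) * g, ?_, by group⟩
  rw [← mem_shell_zero ord, mem_shell, toAdd_ord_zpow_mul hϖ, (mem_shell ord).1 hg, neg_add_cancel]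

/-- **`shell n = (ϖ⁻ⁿ · )⁻¹' ker ord`** — the form from which measurability and volume follow -/
theorem shell_eq_preimage_mul {ϖ : Γ} (hϖ : ord ϖ = Multiplicative.ofAdd 1) (n : ℤ) :
    shell ord n = (fun g => ϖ ^ (-n) * g) ⁻¹' shell ord 0 := by
  ext g
  rw [mem_preimage, mem_shell, mem_shell, toAdd_ord_zpow_mul hϖ, neg_add_eq_zero, eq_comm]

end shells

/-! ## §2 Measurability and volume of the shells (left-invariance only) -/

section measure

variable {Γ : Type*} [Group Γ] [MeasurableSpace Γ] [MeasurableMul Γ] {ord : Γ →* Multiplicative ℤ}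
  {ϖ : Γ}

/-- (Ported verbatim from the HodgeCMPerL package; no docstring in the source.) -/
theorem measurableSet_shell (hϖ : ord ϖ = Multiplicative.ofAdd 1) (h0 : MeasurableSet (shell ord 0))
    (n : ℤ) : MeasurableSet (shell ord n) := by
  rw [shell_eq_preimage_mul hϖ n]
  exact measurable_const_mul _ h0

/-- **all shells have the volume of `ker ord`** under any left-invariant measure -/
theorem measure_shell (μ : Measure Γ) [μ.IsMulLeftInvariant] (hϖ : ord ϖ = Multiplicative.ofAdd 1)
    (n : ℤ) : μ (shell ord n) = μ (shell ord 0) := by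
  rw [shell_eq_preimage_mul hϖ n, measure_preimage_mul]

end measure

/-! ## §3 The canonical local integrand is constant on shells -/

section integrand

variable {ι : Type} {G : ι → Type} [∀ i, Group (G i)] [DecidableEq ι]
  {Sub : ι → Type*} [∀ i, SetLike (Sub i) (G i)] [∀ i, SubgroupClass (Sub i) (G i)]
  (B : ∀ i, Sub i) {Sp : Type} [NormedAddCommGroup Sp] [InnerProductSpace ℂ Sp]
  [∀ i, MeasurableSpace (G i)] [∀ i, MeasurableInv (G i)]
  (D : RestrictedProductMeasureDatum ι G (Πʳ j, [G j, B j])) [∀ i, (D.ν i).IsInvInvariant]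
  (ω : (Πʳ j, [G j, B j]) →* (Sp ≃ₗᵢ[ℂ] Sp)) (φ : Sp) (χ : (Πʳ j, [G j, B j]) →* Circle)

omit [∀ i, MeasurableSpace (G i)] [∀ i, MeasurableInv (G i)] in
/-- right-invariance of the local coefficient under an element fixing `φ` -/
theorem localCoeff_mul_of_fixed (i : ι) {b : G i} (hb : ω (RestrictedProduct.mulSingle B i b) φ = φ)
    (g : G i) : localCoeff B ω φ i (g * b) = localCoeff B ω φ i g := by
  unfold localCoeff
  rw [RestrictedProduct.mulSingle_mul, inner_map_mul_of_fixed B ω φ hb]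

/-- the integrand at `ϖⁿ b`, `b` fixing `φ` with `χ′_i(b) = 1`: `f(ϖⁿ b) = localCoeff(ϖⁿ) · χ′_i(ϖ)ⁿ` -/
theorem localIntegrand_f_zpow_mul (i : ι) (ϖ : G i) {b : G i}
    (hb : ω (RestrictedProduct.mulSingle B i b) φ = φ) (hχb : χ (RestrictedProduct.mulSingle B i b) = 1)
    (n : ℤ) :
    (localIntegrand B D ω φ χ i).f (ϖ ^ n * b) =
      localCoeff B ω φ i (ϖ ^ n) * ((χ (RestrictedProduct.mulSingle B i ϖ) : Circle) : ℂ) ^ n := by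
  rw [localIntegrand_f, localCoeff_mul_of_fixed B ω φ i hb, RestrictedProduct.mulSingle_mul, map_mul,
    hχb, mul_one, ← inclHom_apply, map_zpow, map_zpow, Circle.coe_zpow, inclHom_apply]

/-- **The shell identity at group level.**  Given a valuation `ord` on `G i` with `ord ϖ = 1`, `φ`
fixed by `ω(ι_i b)` and `χ′(ι_i b) = 1` for all `b ∈ ker ord`, and the LATTICE VALUES
`localCoeff(ϖⁿ) = t^{|n|} νᵢⁿ`: on `shell ord n` the canonical local integrand is the constant
`t^{|n|} (χ′_i(ϖ) νᵢ)ⁿ` — the shape of `UnramifiedPlaceData.hF`. -/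
theorem localIntegrand_f_eqOn_shell (i : ι) (ord : G i →* Multiplicative ℤ) (ϖ : G i)
    (hϖ : ord ϖ = Multiplicative.ofAdd 1)
    (hfix : ∀ b : G i, ord b = 1 → ω (RestrictedProduct.mulSingle B i b) φ = φ)
    (hχ : ∀ b : G i, ord b = 1 → χ (RestrictedProduct.mulSingle B i b) = 1) {t nuPi : ℂ}
    (hval : ∀ n : ℤ, localCoeff B ω φ i (ϖ ^ n) = t ^ n.natAbs * nuPi ^ n) (n : ℤ) :
    EqOn (localIntegrand B D ω φ χ i).f
      (fun _ => t ^ n.natAbs * (((χ (RestrictedProduct.mulSingle B i ϖ) : Circle) : ℂ) * nuPi) ^ n)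
      (shell ord n) := by
  intro g hg
  obtain ⟨b, hb, rfl⟩ := exists_eq_zpow_mul hϖ hg
  rw [localIntegrand_f_zpow_mul B D ω φ χ i ϖ (hfix b hb) (hχ b hb) n, hval n, mul_zpow]
  ring

end integrand

/-! ## §4 The split-place model datum and the six fields of `UnramifiedPlaceData` -/

section model

variable {ι : Type} {G : ι → Type} [∀ i, CommGroup (G i)] [∀ i, MeasurableSpace (G i)]
  {Sub : ι → Type*} [∀ i, SetLike (Sub i) (G i)] [∀ i, SubgroupClass (Sub i) (G i)]
  (B : ∀ i, Sub i) [DecidableEq ι]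
  {Sp : Type} [NormedAddCommGroup Sp] [InnerProductSpace ℂ Sp]
  (D : RestrictedProductMeasureDatum ι G (Πʳ j, [G j, B j]))
  (ω : (Πʳ j, [G j, B j]) →* (Sp ≃ₗᵢ[ℂ] Sp)) (φ : Sp) (χ : (Πʳ j, [G j, B j]) →* Circle)

/-- **The split-place datum at `i`** (tex l. 629–630 vocabulary): a valuation `ord` of `G i`
(`= U(W_{i,v}) ≅ F_v^×`) with kernel `B i` (`= 𝒪_v^×`), a uniformizer `ϖ`, `B i` measurable of
`ν_i`-volume one (`d^×y` normalised), `φ` fixed by `ω(ι_i 𝒪_v^×)` ("φ⁰ fixed by U(W_i)(𝒪_v)"),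
`χ′` unramified at `i`, and the lattice values `⟪φ, ω(ι_i ϖⁿ)φ⟫ = (q^{-3/2})^{|n|} νᵢⁿ` (the D4
model computation — KERNEL in the dilation model, pv07-g2 + `SplitPlaceDilation.lean`). -/
structure SplitPlaceModel (i : ι) (q : ℕ) (chiPi nuPi : ℂ) where
  /-- the place valuation `ord_v` on `G i` -/
  ord : G i →* Multiplicative ℤ
  /-- a uniformizer -/
  ϖ : G i
  ord_ϖ : ord ϖ = Multiplicative.ofAdd 1
  /-- `ker ord_v = B i` (`= 𝒪_v^×`) -/
  ker_ord : ∀ g : G i, ord g = 1 ↔ g ∈ B i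
  measurableSet_B : MeasurableSet (B i : Set (G i))
  /-- `ν_i(𝒪_v^×) = 1` -/
  vol_B : D.ν i (B i : Set (G i)) = 1
  /-- `φ` is `ω(ι_i 𝒪_v^×)`-fixed -/
  fixed : ∀ b : G i, b ∈ B i → ω (RestrictedProduct.mulSingle B i b) φ = φ
  /-- `χ′` is unramified at `i` -/
  unram : ∀ b : G i, b ∈ B i → χ (RestrictedProduct.mulSingle B i b) = 1
  /-- `χ′_i(ϖ) = chiPi` -/
  chiPi_eq : ((χ (RestrictedProduct.mulSingle B i ϖ) : Circle) : ℂ) = chiPi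
  /-- the lattice values of the local coefficient: `⟪φ, ω(ι_i ϖⁿ)φ⟫ = (q^{-3/2})^{|n|} νᵢⁿ` -/
  coeff_zpow : ∀ n : ℤ,
    localCoeff B ω φ i (ϖ ^ n) = ((EulerProduct.tOf q : ℝ) : ℂ) ^ n.natAbs * nuPi ^ n

namespace SplitPlaceModel

variable {B D ω φ χ} {i : ι} {q : ℕ} {chiPi nuPi : ℂ} (M : SplitPlaceModel B D ω φ χ i q chiPi nuPi)

/-- the shells `P n := {ord = n} = ϖⁿ 𝒪_v^×` -/
def P (n : ℤ) : Set (G i) := shell M.ord n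

/-- (Ported verbatim from the HodgeCMPerL package; no docstring in the source.) -/
theorem P_zero_eq : M.P 0 = (B i : Set (G i)) := shell_zero_eq M.ord M.ker_ord

/-- field `hd` -/
theorem hd : Pairwise (Disjoint on M.P) := pairwise_disjoint_shell M.ord

/-- field `hcover` -/
theorem hcover : (⋃ n, M.P n) = Set.univ := iUnion_shell M.ord

variable [∀ i, MeasurableMul (G i)]

/-- field `hm` -/
theorem hm (n : ℤ) : MeasurableSet (M.P n) := by
  have h : MeasurableSet (M.P 0) := by rw [M.P_zero_eq]; exact M.measurableSet_B
  exact measurableSet_shell M.ord_ϖ h n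

/-- field `hvol` (left-invariance of `ν_i` + `ν_i(𝒪_v^×) = 1`) -/
theorem hvol [(D.ν i).IsMulLeftInvariant] (n : ℤ) : D.ν i (M.P n) = 1 := by
  rw [P, measure_shell (D.ν i) M.ord_ϖ n, ← P, M.P_zero_eq, M.vol_B]

omit [∀ i, MeasurableMul (G i)] in
/-- field `hF` -/
theorem hF [∀ i, MeasurableInv (G i)] [∀ i, (D.ν i).IsInvInvariant] (n : ℤ) :
    Set.EqOn (localIntegrand B D ω φ χ i).f
      (fun _ => ((EulerProduct.tOf q : ℝ) : ℂ) ^ n.natAbs * (chiPi * nuPi) ^ n) (M.P n) := by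
  intro g hg
  have h := localIntegrand_f_eqOn_shell B D ω φ χ i M.ord M.ϖ M.ord_ϖ
    (fun b hb => M.fixed b ((M.ker_ord b).1 hb)) (fun b hb => M.unram b ((M.ker_ord b).1 hb))
    M.coeff_zpow n hg
  rw [h, M.chiPi_eq]

end SplitPlaceModel

open scoped Classical in
/-- **pv09-g3's `UnramifiedPlaceData` ASSEMBLED**: split models at the split unramified places
(the six split fields become theorems), the non-split data (`hBi`, `hν1` — pv09-g3
`UnramifiedNonsplit` / set-up) and the numerics. -/
def unramifiedPlaceDataOfModels [∀ i, MeasurableInv (G i)] [∀ i, (D.ν i).IsInvInvariant]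
    [∀ i, MeasurableMul (G i)] [∀ i, (D.ν i).IsMulLeftInvariant]
    {S : Finset ι} {q : ι → ℕ} {chiPi nuPi : ι → ℂ} {IsSplit : ι → Prop}
    (M : ∀ i, i ∉ S → IsSplit i → SplitPlaceModel B D ω φ χ i (q i) (chiPi i) (nuPi i))
    (hBi : ∀ i, i ∉ S → ¬IsSplit i → (B i : Set (G i)) = Set.univ)
    (hν1 : ∀ i, i ∉ S → ¬IsSplit i → D.ν i Set.univ = 1)
    (two_le_q : ∀ i, i ∉ S → 2 ≤ q i) (chi_norm : ∀ i, i ∉ S → ‖chiPi i‖ = 1)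
    (nu_norm : ∀ i, i ∉ S → ‖nuPi i‖ = 1) :
    UnramifiedPlaceData B D ω φ χ S q chiPi nuPi IsSplit where
  P i n := if h : i ∉ S ∧ IsSplit i then (M i h.1 h.2).P n else ∅
  hm i hi hs n := by simp only [dif_pos (And.intro hi hs)]; exact (M i hi hs).hm n
  hd i hi hs := by simp only [dif_pos (And.intro hi hs)]; exact (M i hi hs).hd
  hcover i hi hs := by simp only [dif_pos (And.intro hi hs)]; exact (M i hi hs).hcover
  hvol i hi hs n := by simp only [dif_pos (And.intro hi hs)]; exact (M i hi hs).hvol n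
  hF i hi hs n := by simp only [dif_pos (And.intro hi hs)]; exact (M i hi hs).hF n
  hBi := hBi
  hν1 := hν1
  two_le_q := two_le_q
  chi_norm := chi_norm
  nu_norm := nu_norm

end model

end HodgeCM.PerL34.SplitShells
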